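import Summits.ABC.ABC.Theses.FeketeScales
import Summits.ABC.ABC.Theorems.FeketeScalesSparseGoodScalesWindow
import Summits.ABC.ABC.Theorems.SparseGoodScales.Negative.EveryScale
import Summits.ABC.ABC.Theorems.SparseGoodScales.Negative.LoadBearing
import Literature.NumberTheory.DiophantineGeometry.AbcQualityProofs

/-!
# Disproof of `SparseGoodScales` — findings (cdisprove seat, stmt-ABC-2161, cycle 1, 2026-08-16)

Crux (route ABC/FeketeScales, rank 3), verbatim:
`∀ δ > 0, ∀ N, ∃ R ≥ N, ∀ a b c, IsABCTriple a b c → rad a b c ≤ R → (c : ℝ) ≤ (R : ℝ) ^ (1 + δ)`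
— "abc along SOME unbounded sequence of radical scales", i.e. `liminf_R log G(R)/log R ≤ 1` for the
record height `G(R) := max {c : rad(abc) ≤ R}`.

READ-BACK (§0): `IsABCTriple a b c = 0 < a ∧ 0 < b ∧ a + b = c ∧ Nat.Coprime a b`; `rad` is Mathlib's
`radical` computed in `ℕ` and cast afterwards; `(R : ℝ) ^ (1 + δ)` is `Real.rpow` with base `≥ 0`, so no
junk value is reachable (`R = 0` forces no triple since `rad ≥ 1`... indeed `rad ≥ 2` for every abc triple,
so scales `R ≤ 1` are vacuously good but serve only `N ≤ 1`); quantifier order `∀δ ∀N ∃R ∀triple` as in the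
informal text. Nothing mis-typed.

VERDICT OF THIS FILE: the crux RESISTS disproof, for the cleanest possible reason — it is a CONSEQUENCE OF
THE SUMMIT: `Summit.ABC.ABC.Theorems.sparseGoodScales_of_abc : ABC → SparseGoodScales` (lead, p96117), hence
`not_sparseGoodScales_imp_not_abc` (§1). A refutation `¬ SparseGoodScales` is a proof of `¬ ABC` WITH
DENSITY: some `δ₀ > 0` and a covering chain of exceptional triples `T_i` (quality `> 1 + δ₀`) whose shadows
`[rad T_i, c_i^{1/(1+δ₀)})` cover a neighbourhood of infinity (§1, `Negative.not_sparseGoodScales_iff`, landed in `Negative/NormalForms.lean` p106845). Every known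
high-quality family has quality `→ 1` (Stewart–Tijdeman / van Frankenhuysen / Bright: excess
`exp((log rad)^{1/2±o(1)})`, `Literature.Barriers.ABC.EpsilonCannotBeDropped`), so no construction
principle in print comes near. The same holds for both stubs of the picked line `Sketch` (§5).

WHAT IS FALSE, AND PROVED FALSE (landed under `Theorems/SparseGoodScales/Negative/`, importable):
* §2 `Negative/EveryScale.lean` (p98545, ACCEPTED): **`liminf_R G(R)/R = +∞`** —
  `exists_triple_gt_mul_at_scale : ∀ K, ∃ N, ∀ R ≥ N, ∃ abc triple, rad ≤ R ∧ K·R < c`.  Mechanism: ONE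
  LOGARITHM BELOW THE CRUX a covering chain DOES exist and is elementary: `m = 12K+1`, Euler
  `2^e ≡ 3^e ≡ 1 (mod m²)`, Dirichlet's approximation theorem gives a rational step `P^s/Q^t ∈ (1,2]`
  (`{P,Q} = {2,3}`, `e ∣ s,t`), the geometric chain `P^{si} Q^{t(H−i)}` puts some `c ≡ 1 (mod m²)` in
  `(KR, 2KR]`, and `(1, c−1, c)` has `rad ≤ 6 (c−1)/m < R`.  It sharpens the lead's "Dirichlet side"
  `SubmultOfRST.exists_triple_at_scale` (`R < 4c`) to `K·R < c` eventually, for every `K`.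
* §2 `Negative/LinearScalesFail.lean` (p104011, ACCEPTED): consequences — `not_linearGoodScales C` (no
  constant `C` admits arbitrarily large scales with `c ≤ C·R`), `not_sparseGoodScalesAt_of_nonpos` (the
  crux's matrix is FALSE for every fixed `δ ≤ 0`: the side condition `0 < δ` is load-bearing and sharp),
  `not_sparseGoodScales_uniform` (no unbounded set of scales is good for all `δ > 0` at once: the `∃ R`
  must depend on `δ`).
* §3 `Negative/LoadBearing.lean` (p101471, ACCEPTED; defs in async audit): coprimality and the
  equation `a + b = c` are load-bearing (`(2^k,2^k,2^{k+1})`, `(1,1,2^k)` have radical `2`); positivity is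
  NOT (a zero entry forces `c = 1`): `SparseGoodScales → SparseGoodScalesWithoutPos`.
* §4 `Negative/ScaleCensus.lean` (p102249, ACCEPTED; `def GoodScale` in async audit): the `∀ R`-strengthening is
  false — `R = 6` is not `1/5`-good (`(1,8,9)`), `R = 15042` is not `δ`-good for any `δ ≤ 0.6299` (Reyssat,
  `Literature.Barriers.ABC.ExplicitABCQualityFloor`); shadow lemma and monotonicity in `δ`.
COMPUTATION (§6): hits `c ≤ 10^6` (1269 abc triples with `c > rad`, local sieve, 19 s): at exponent 1 the
ONLY scales `R ∈ [2, 10^6)` not certified bad are `R ∈ [9, 29]` (`G(R) = 9`); covering certificate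
(`compute/cover_job.py`, evidence `cover_chain_1e300.txt`, 34 s locally, self-verified; queued too as kit
job j017836): 256 triples `(1, b, b+1)` with a `{2,3,5,7}`-smooth member whose shadows `[rad, c)` cover
EVERY `R ∈ [30, 1.75·10^300)`; its first ten lines are KERNEL-CHECKED in `Negative/SmallScales.lean`
(`exists_triple_straddle : 30 ≤ R < 7^{12} → ∃ abc, rad ≤ R < c`, proposal pending farm). Conjecture
recorded as a near-miss (§7): `∀ R ≥ 30, G(R) > R` (explicit threshold; the landed theorem's `N(K)` is
elementary but astronomically large — e.g. instantiating its Dirichlet step for `K = 1` (`m = 13`,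
`e = φ(169) = 156`) by the convergent `84/53` gives the step `3^{53·156}/2^{84·156} ≈ 1.41` and
`N ≈ (2^{13104})^{H₀+1}` with `H₀ ≈ 2.7·10^4`).

* §1/§5 `Negative/NormalForms.lean` (p106845, ACCEPTED): `not_sparseGoodScales_iff` (normal form of the
  negation) and `windowed_trivial_of_le_one` (`1 < Λ` carries the content of the windowed stub); primed
  copies below only because the farm had not built that module when this work file was published.
WHY NOTHING HERE THREATENS THE CRUX: all witnesses live at quality `1 + O(1/log R)` — the chain gains a
factor `m = 12K+1` over `R`, i.e. `log c/log R = 1 + log(2K)/log R → 1`. To bite at a fixed `δ₀ > 0` the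
powerful excess `(c−1)/rad(c−1)` would have to be `≥ R^{δ₀}` at EVERY large scale, i.e. a positive-density
(in `log log` scale, gap ratio bounded) supply of triples of quality `≥ 1 + δ₀` — against the `X^{33/50}`
exceptional-set count nothing forbids it, but no mechanism produces it (BarrierNotes-r1-k2 N1(b), N5).
-/

noncomputable section

namespace Summit.ABC.ABC.Cruxes.SparseGoodScales.Disproof

open Literature.NumberTheory.DiophantineGeometry UniqueFactorizationMonoid
open Summit.ABC.ABC.Theses.FeketeScales
open Summit.ABC.ABC.Theorems
open Summit.ABC.ABC.Theorems.SparseGoodScales.Negative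

/-! ## §1 Why the crux resists: it is implied by the summit; normal form of its negation -/

/-- **Any disproof of the crux disproves the abc conjecture** (contrapositive of the lead's calibration
`sparseGoodScales_of_abc`, p96117). [folklore] -/
theorem not_sparseGoodScales_imp_not_abc : ¬ SparseGoodScales → ¬ _root_.ABC :=
  fun h habc => h (sparseGoodScales_of_abc habc)

/-- **Normal form of the negation** (what a counterexample must be; landed as
`Negative.not_sparseGoodScales_iff`, p106845): some `δ₀ > 0` and a threshold `N` beyond which EVERY scale
carries an exceptional triple — `rad ≤ R` and `c > R^{1+δ₀}` — i.e. a covering chain of triples of quality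
`> 1 + δ₀` (shadows `[rad T, c_T^{1/(1+δ₀)})` covering `[N, ∞)`). [folklore] -/
theorem not_sparseGoodScales_iff' :
    ¬ SparseGoodScales ↔ ∃ δ : ℝ, 0 < δ ∧ ∃ N : ℕ, ∀ R : ℕ, N ≤ R →
      ∃ a b c : ℕ, IsABCTriple a b c ∧ rad a b c ≤ R ∧ (R : ℝ) ^ (1 + δ) < c := by
  constructor
  · intro h
    by_contra hne
    apply h
    intro δ hδ N
    by_contra hR
    apply hne
    refine ⟨δ, hδ, N, fun R hNR => ?_⟩
    by_contra hT
    apply hR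
    refine ⟨R, hNR, fun a b c ht hr => ?_⟩
    by_contra hc
    exact hT ⟨a, b, c, ht, hr, not_le.mp hc⟩
  · rintro ⟨δ, hδ, N, hN⟩ h
    obtain ⟨R, hNR, hR⟩ := h δ hδ N
    obtain ⟨a, b, c, ht, hr, hc⟩ := hN R hNR
    exact absurd (hR a b c ht hr) (not_le.mpr hc)

/-! ## §2 Tightness in `δ`: one logarithm below the crux the covering chain EXISTS (landed)

`Negative/EveryScale.lean` (p98545): `exists_triple_gt_mul_at_scale`, `exists_triple_gt_real_mul_at_scale`.
Consequences landed in `Negative/LinearScalesFail.lean` (p104011, ACCEPTED; not imported by this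
version of the work file only because the farm had not built it yet): `not_linearGoodScales`,
`not_sparseGoodScalesAt_zero`, `not_sparseGoodScalesAt_of_nonpos` (every `δ ≤ 0`),
`not_sparseGoodScales_uniform` (no scales good uniformly in `δ`). The two central ones are re-derived here. -/

example (K : ℕ) : ∃ N : ℕ, ∀ R : ℕ, N ≤ R → ∃ a b c : ℕ, IsABCTriple a b c ∧ rad a b c ≤ R ∧ K * R < c :=
  exists_triple_gt_mul_at_scale K

/-- **`δ = 0` is excluded**: the crux's matrix at exponent `1 + 0` fails — `G(R) > R` at every large
scale. (Landed form: `Negative.not_sparseGoodScalesAt_zero`.) [folklore] -/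
theorem sparseGoodScales_false_at_zero :
    ¬ ∀ N : ℕ, ∃ R : ℕ, N ≤ R ∧ ∀ a b c : ℕ, IsABCTriple a b c → rad a b c ≤ R →
      (c : ℝ) ≤ (R : ℝ) ^ (1 + (0 : ℝ)) := by
  intro h
  obtain ⟨N, hN⟩ := exists_triple_gt_real_mul_at_scale 1
  obtain ⟨R, hNR, hR⟩ := h N
  obtain ⟨a, b, c, ht, hr, hc⟩ := hN R hNR
  have h1 := hR a b c ht hr
  simp at h1
  have h2 : (c : ℝ) ≤ R := by exact_mod_cast h1
  linarith

/-- **No linear good scales, any constant** (landed form: `Negative.not_linearGoodScales`): the natural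
strengthening "`c ≤ C·R` at arbitrarily large scales" is false for every `C`. [folklore] -/
theorem sparseGoodScales_false_linear (C : ℝ) :
    ¬ ∀ N : ℕ, ∃ R : ℕ, N ≤ R ∧ ∀ a b c : ℕ, IsABCTriple a b c → rad a b c ≤ R → (c : ℝ) ≤ C * R := by
  intro h
  obtain ⟨N, hN⟩ := exists_triple_gt_real_mul_at_scale C
  obtain ⟨R, hNR, hR⟩ := h N
  obtain ⟨a, b, c, ht, hr, hc⟩ := hN R hNR
  exact absurd (hR a b c ht hr) (not_le.mpr hc)

/-! ## §3 Load-bearing hypotheses (landed home: `Negative/LoadBearing.lean`, p101471)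

* `SparseGoodScalesWithoutCoprime` — FALSE (`(2^k, 2^k, 2^{k+1})`, radical `2`, unbounded height);
* `SparseGoodScalesWithoutSum` — FALSE (`(1, 1, 2^k)`);
* `SparseGoodScalesWithoutPos` — EQUIVALENT to the crux (a zero entry with `a+b=c`, `Coprime a b` forces
  `c = 1`): positivity is decoration; any proof may ignore it. -/

example : ¬ SparseGoodScalesWithoutCoprime := sparseGoodScales_false_without_coprime
example : ¬ SparseGoodScalesWithoutSum := sparseGoodScales_false_without_sum
example : SparseGoodScales → SparseGoodScalesWithoutPos := sparseGoodScalesWithoutPos_of_sparseGoodScales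

/-! ## §4 The `∃ R` cannot be `∀ R` (landed home: `Negative/ScaleCensus.lean`, p102249)

`GoodScale δ R := ∀ abc, rad ≤ R → c ≤ R^{1+δ}`; crux `↔ ∀ δ>0 ∀ N ∃ R ≥ N, GoodScale δ R` (`Iff.rfl`).
Certified bad scales: `R = 6` at `δ = 1/5` (`(1,8,9)`, below), `R = 15042` at every `δ ≤ 0.6299` (Reyssat).
Under `ABC` every SUFFICIENTLY large scale is good, so no threshold-free `∀R` form can be refuted beyond
exhibiting bad scales; the interesting question is only the liminf. -/

-- Landed in `Negative/ScaleCensus.lean` (p102249; not imported here to keep this work file's import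
-- closure inside route FeketeScales — ScaleCensus reaches `Theses.IneffectiveSubspace` through
-- `PrimePowerRadical/Negative/Tightness.lean`):
--   `sparseGoodScales_iff_goodScale : SparseGoodScales ↔ ∀ δ > 0, ∀ N, ∃ R ≥ N, GoodScale δ R`
--   `not_goodScale_six : ¬ GoodScale (1/5) 6`,  `not_goodScale_reyssat : δ ≤ 0.6299 → ¬ GoodScale δ 15042`
--   `not_forall_goodScale : ¬ ∀ δ > 0, ∀ R ≥ 15042, GoodScale δ R`

/-- `R = 6` is a bad scale at `δ = 1/5`: `(1,8,9)`, `rad = 6`, `6^{6/5} < 9`. [folklore] -/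
theorem badScale_six : ∃ a b c : ℕ, IsABCTriple a b c ∧ rad a b c ≤ 6 ∧
    ((6 : ℕ) : ℝ) ^ (1 + (1 / 5 : ℝ)) < c := by
  have hrad : rad 1 8 9 = 6 := by
    rw [rad_def, show (1 * 8 * 9 : ℕ) = 2 ^ 3 * 3 ^ 2 by norm_num,
      radical_mul (by rw [← Nat.coprime_iff_isRelPrime]; norm_num),
      radical_pow _ (by norm_num), radical_pow _ (by norm_num),
      radical_eq_self_of_prime (by norm_num), radical_eq_self_of_prime (by norm_num)]
    all_goals norm_num
  refine ⟨1, 8, 9, ⟨by norm_num, by norm_num, by norm_num, by norm_num⟩, by rw [hrad], ?_⟩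
  -- 6^(6/5) < 9  ⟸  6^6 = 46656 < 59049 = 9^5
  have h5 : (((6 : ℕ) : ℝ) ^ (1 + 1 / 5 : ℝ)) ^ (5 : ℕ) = 46656 := by
    rw [← Real.rpow_natCast, ← Real.rpow_mul (by norm_num),
      show ((1 : ℝ) + 1 / 5) * ((5 : ℕ) : ℝ) = ((6 : ℕ) : ℝ) by norm_num, Real.rpow_natCast]
    norm_num
  by_contra hge
  rw [not_lt] at hge
  have : ((9 : ℕ) : ℝ) ^ (5 : ℕ) ≤ (((6 : ℕ) : ℝ) ^ (1 + 1 / 5 : ℝ)) ^ (5 : ℕ) :=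
    pow_le_pow_left₀ (by positivity) hge 5
  rw [h5] at this
  norm_num at this

/-! ## §5 Line `Sketch` (PICKED): stubs `stub_boundedQuality` (BQ) and `stub_windowedGoodScales` (WGS)

Both stubs are consequences of `ABC` (lead: `sparseGoodScales_boundedQuality_iff_polynomialABC`,
`sparseGoodScales_windowed_of_abc`), so NEITHER CAN BE KILLED short of `¬ABC`; joint sufficiency
`BQ → WGS → SGS` is kernel-checked (`sparseGoodScales_of_boundedQuality_of_windowed`), and conversely
`SGS → WGS`, `BQ → (SGS ↔ WGS)`: the composition smuggles no gap — modulo BQ the horizontal stub IS the crux.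
Hypothesis mutation of WGS (`∀ δ>0 ∀ Λ>1 ∀ N ∃ R ≥ N ∀ abc, rad ≤ R → R < rad^Λ → c ≤ R^{1+δ}`):
* `1 < Λ` dropped: for `Λ ≤ 1` the window `rad ≤ R < rad^Λ` is EMPTY (`rad ≥ 1`), so WGS is vacuously
  true there (`windowed_trivial_of_le_one`) — `1 < Λ` carries the content, not the truth;
* `0 < δ` dropped (WGS at `δ = 0`): NOT refuted by §2 — the chain triples `(1, c−1, c)` come with an
  UPPER bound on `rad(c−1)` only; placing them inside the window needs a LOWER bound
  `rad(2^x 3^y − 1) > R^{1/Λ}`, which is an abc-type statement for the `{2,3}`-family (open; cf.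
  BarrierNotes N2 on `(1, 2^k−1, 2^k)`). Recorded as near-miss `windowed_false_at_zero` (§7).
* BQ's role: without BQ, SGS ⇏? nothing to refute (SGS → WGS unconditionally). -/

/-- For `Λ ≤ 1` the window hypothesis `R < rad^Λ` contradicts `rad ≤ R`, so the windowed statement holds
vacuously: the side condition `1 < Λ` of `stub_windowedGoodScales` is what gives it content (landed as
`Negative.windowed_trivial_of_le_one`, p106845). [folklore] -/
theorem windowed_trivial_of_le_one' {Λ : ℝ} (hΛ : Λ ≤ 1) (δ : ℝ) (N : ℕ) :
    ∃ R : ℕ, N ≤ R ∧ ∀ a b c : ℕ, IsABCTriple a b c → rad a b c ≤ R →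
      (R : ℝ) < ((rad a b c : ℕ) : ℝ) ^ Λ → (c : ℝ) ≤ (R : ℝ) ^ (1 + δ) := by
  refine ⟨max N 1, le_max_left _ _, fun a b c _ hr hwin => ?_⟩
  exfalso
  have hrad1 : (1 : ℝ) ≤ ((rad a b c : ℕ) : ℝ) := by
    exact_mod_cast Nat.one_le_iff_ne_zero.mpr (by rw [rad_def]; exact radical_ne_zero)
  have h1 : ((rad a b c : ℕ) : ℝ) ^ Λ ≤ ((rad a b c : ℕ) : ℝ) ^ (1 : ℝ) :=
    Real.rpow_le_rpow_of_exponent_le hrad1 hΛ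
  rw [Real.rpow_one] at h1
  have h2 : ((rad a b c : ℕ) : ℝ) ≤ ((max N 1 : ℕ) : ℝ) := by exact_mod_cast hr
  linarith

/-! ## §6 Computation (evidence, not proof)

* Local sieve (compute/hits.py, 19 s): all 1269 abc triples with `c > rad`, `c ≤ 10^6`. At exponent 1 the
  set of scales `R ∈ [2,10^6)` NOT certified bad is exactly `[9, 29]` (`G(R) = 9 ≤ R` there; the
  `{2,3},{2,5},{2,7},{2,11},{2,13}`-unit equations have largest solution `9`). Pre-record sawtooth values
  `sq(R⁻) = log G/log R` (certain while `G < 10^6`): 1.168 (R=209), 1.254 (1109), 1.464 (1217),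
  1.389 (2729), 1.358 (4289), 1.398 (7409), 1.414 (9029), 1.373 (14429) — no dip towards 1 in range,
  as BarrierNotes N7 predicts (data cannot speak below `c ≈ 10^20`).
* Covering certificate (`compute/cover_job.py`; evidence `cover_chain_1e300.txt`; kit job j017836 queued
  with the same script, JOB_LOG10X=300): greedy chain of abc triples `(1, b, b+1)` (one member
  `{2,3,5,7}`-smooth, the other's radical bounded by partial trial division `rad n ≤ n/u`, primes `≤ 3000`)
  whose shadows `[rad, c)` cover `[30, 1.75·10^300)`: 256 triples, jump ratios `c/F ∈ [2.7, 16]`, 34 s,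
  independent verification pass. First ten steps (to `7^{12}`) formalised in `Negative/SmallScales.lean`.
  Supports the explicit conjecture `∀ R ≥ 30, G(R) > R`. -/

/-! ## §7 Near-misses (sorry permitted in this work file only) -/

/-- NEAR-MISS (explicit threshold for §2 at `K = 1`): every scale `R ≥ 30` is bad at exponent 1.
Evidence: kernel-checked for `30 ≤ R < 7^{12}` (`Negative/SmallScales.lean`), certified for `R < 1.75·10^300`
by the covering certificate (`cover_chain_1e300.txt`, kit j017836); asymptotically by
`exists_triple_gt_mul_at_scale 1` (with an astronomically large, though computable, `N`). Obstruction to a proof: the landed chain argument starts only at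
`N ≈ 2^{13104·H₀}`; closing the gap needs either a finer explicit covering argument for the lattice
`{(x,y) : 2^x 3^y ≡ 1 (169)}` (threshold `≈ e^{156}`) plus a certificate to `10^{70}`, or more families.
Not needed for any verdict; recorded for the provers as the honest shape of "δ = 0 fails". -/
theorem badScale_from_thirty (R : ℕ) (hR : 30 ≤ R) :
    ∃ a b c : ℕ, IsABCTriple a b c ∧ rad a b c ≤ R ∧ R < c := by
  sorry

/-- NEAR-MISS (WGS at `δ = 0`, see §5): windowed good scales with exponent exactly 1 should be false for
every `Λ > 1`, but the chain of §2 gives no LOWER bound on the radical of its witnesses; a proof needs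
`rad(2^x 3^y − 1) ≥ (2^x 3^y)^{1/Λ}` along a covering sub-chain — abc-strength information on the
`{2,3}`-unit family. Tried: nothing beyond noting that Stewart's `P(2^k − 1) ≥ k exp(log k/(104 log log k))`
is far too weak. -/
theorem windowed_false_at_zero (Λ : ℝ) (hΛ : 1 < Λ) :
    ¬ ∀ N : ℕ, ∃ R : ℕ, N ≤ R ∧ ∀ a b c : ℕ, IsABCTriple a b c → rad a b c ≤ R →
      (R : ℝ) < ((rad a b c : ℕ) : ℝ) ^ Λ → (c : ℝ) ≤ (R : ℝ) ^ (1 + (0 : ℝ)) := by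
  sorry

end Summit.ABC.ABC.Cruxes.SparseGoodScales.Disproof
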